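import Literature.Computability.AlgebraicComplexity.ConstituentStageData
import Literature.Computability.AlgebraicComplexity.FirstTypeHoleBound
import HarnessLib

/-!
# The universe of level-`(ℓ−1)` block triples of the constituent stage and the symmetry of its degrees
(Vassilevska Williams–Xu–Xu–Zhou 2024, §6.2: `numxblock`, `numtriple`, "If the `t`-th part of a
level-`(ℓ−1)` `X`-index sequence is not consistent with the distribution `γ̃_{X,t}` for any `t`, we zero
out the corresponding level-`(ℓ−1)` `X`-block", and the symmetry behind Claims 6.6–6.8) — proved

Topic `Literature/Computability/AlgebraicComplexity`.  §6.2 of Vassilevska Williams–Xu–Xu–Zhou,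
*New bounds for matrix multiplication: from alpha to omega* (SODA 2024, arXiv:2307.07970) first zeroes
out the level-`(ℓ−1)` blocks whose index sequence, viewed "as a length-`n_t` `{0,…,2^{ℓ−1}}²`-sequence
by combining pairs of adjacent numbers", is not consistent with the one-level split distribution
`γ̃_{W,t}` on the `t`-th term, and then hashes the remaining block triples exactly as in §5.2 (Claims
6.6–6.8 "analogous to the claims in §5", whose proofs use that "by symmetry, each `X`-block is in the
same number of block triples").  This file sets up that universe on the tree's half-chunk positions
(`ConstituentStageData.lean`: position `u < n` = left half of chunk `u`, `n + u` = its right half) and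
PROVES the symmetry:

* `halfPairs`, `ofHalfPairs`, `doublePerm` — a sequence on half-chunk positions as a sequence of PAIRS
  on chunks; a chunk permutation acting on both halves;
* `pairTypeClass τ k` — **the remaining level-`(ℓ−1)` `W`-blocks**: sequences whose pair sequence has
  the prescribed pair counts `k t` on every term (`= n_t · γ̃_{W,t}`; a `multiTypeClass` of
  `FirstTypeHoleBound.lean`), with `insideX_of_mem_pairTypeClass` (they lie inside the level-`ℓ` blocks
  when `k t` is supported on pairs summing to `i_t`);
* `exists_chunkSymm_chunkPerm_eq`, `exists_chunkSymm_of_mem_pairTypeClass` — **transitivity**: the chunk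
  symmetries of the term map (`chunkSymmetries τ ≅ ∏_t S_{n_t}`) act transitively on every multi-class
  type class, hence on `pairTypeClass τ k`;
* `tripleUniverse τ kX kY kZ` — **the remaining level-`(ℓ−1)` block triples `𝒯`** (`numtriple = |𝒯|`):
  triples of remaining blocks with `I_p + J_p + K_p = 2c` at every position (a level family), stable under
  the symmetries (`permTriple_mem_tripleUniverse`);
* `card_filter_fst_eq_eq`, `degX_mul_card_pairTypeClass` (and `Y`) — **"by symmetry, each `X`-block is
  in the same number of block triples, which is `numtriple/numxblock`"**:
  `#{T ∈ 𝒯 | T.1 = I} · |pairTypeClass τ kX| = |𝒯|` for every remaining `I`;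
* `eight_mul_degX_le`, `eight_mul_degY_le` — the requirement
  `M ≥ 8 · max{numtriple/numxblock, numtriple/numyblock}` gives the degree bounds `8 · deg_X(T) ≤ M`,
  `8 · deg_Y(T) ≤ M` consumed by the general Claims 6.7–6.8.

Everything is proved; the definitions are the ones listed; no named facts.

## References

* V. Vassilevska Williams, Y. Xu, Z. Xu, R. Zhou, *New bounds for matrix multiplication: from alpha
  to omega*, SODA 2024, arXiv:2307.07970 (held: `paper:arxiv-2307.07970`), §6.2 (first three
  paragraphs, the requirement on `M₀`, Claims 6.6–6.8) and the proof of Claim 5.6 ("by symmetry").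
  [VassilevskaWilliamsXuXuZhou2024]
-/

noncomputable section

open scoped BigOperators
open Finset

namespace Literature.Computability.AlgebraicComplexity

/-! ## Sequences on half-chunk positions as sequences of pairs; doubled chunk permutations -/

section HalfPairs

variable {α : Type*} {n : ℕ}

/-- **The pair sequence** of a sequence on half-chunk positions: chunk `u ↦ (I(left u), I(right u))`
("a length-`n_t` `{0,…,2^{ℓ−1}}²`-sequence by combining pairs of adjacent numbers").
[cite: VassilevskaWilliamsXuXuZhou2024, §6.2] -/
def halfPairs (I : Fin (n + n) → α) : Fin n → α × α := fun u => (I (Fin.castAdd n u), I (Fin.natAdd n u))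

/-- Entries of the pair sequence. [folklore] -/
@[simp] theorem halfPairs_apply (I : Fin (n + n) → α) (u : Fin n) :
    halfPairs I u = (I (Fin.castAdd n u), I (Fin.natAdd n u)) := rfl

/-- The inverse re-indexing: a sequence of pairs as a sequence on half-chunk positions. [folklore] -/
def ofHalfPairs (w : Fin n → α × α) : Fin (n + n) → α :=
  fun p => Fin.addCases (motive := fun _ => α) (fun u => (w u).1) (fun u => (w u).2) p

/-- Left entries. [folklore] -/
@[simp] theorem ofHalfPairs_castAdd (w : Fin n → α × α) (u : Fin n) : ofHalfPairs w (Fin.castAdd n u) = (w u).1 :=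
  Fin.addCases_left (motive := fun _ => α) u

/-- Right entries. [folklore] -/
@[simp] theorem ofHalfPairs_natAdd (w : Fin n → α × α) (u : Fin n) : ofHalfPairs w (Fin.natAdd n u) = (w u).2 :=
  Fin.addCases_right (motive := fun _ => α) u

/-- `halfPairs ∘ ofHalfPairs = id`. [folklore] -/
@[simp] theorem halfPairs_ofHalfPairs (w : Fin n → α × α) : halfPairs (ofHalfPairs w) = w := by
  funext u
  rw [halfPairs_apply, ofHalfPairs_castAdd, ofHalfPairs_natAdd]

/-- `ofHalfPairs ∘ halfPairs = id`. [folklore] -/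
@[simp] theorem ofHalfPairs_halfPairs (I : Fin (n + n) → α) : ofHalfPairs (halfPairs I) = I := by
  funext p
  refine Fin.addCases (fun u => ?_) (fun u => ?_) p
  · rw [ofHalfPairs_castAdd, halfPairs_apply]
  · rw [ofHalfPairs_natAdd, halfPairs_apply]

/-- `halfPairs` is injective. [folklore] -/
theorem halfPairs_injective : Function.Injective (halfPairs : (Fin (n + n) → α) → Fin n → α × α) := by
  intro I I' h
  rw [← ofHalfPairs_halfPairs I, h, ofHalfPairs_halfPairs]

/-- **A chunk permutation acting on both halves of every chunk** (a permutation of the half-chunk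
positions). [cite: VassilevskaWilliamsXuXuZhou2024, §7 (proof of Cor. 4.2: "randomly permute chunks within the same term")] -/
def doublePerm (σ : Equiv.Perm (Fin n)) : Equiv.Perm (Fin (n + n)) := finSumFinEquiv.permCongr (Equiv.sumCongr σ σ)

/-- On left halves. [folklore] -/
@[simp] theorem doublePerm_castAdd (σ : Equiv.Perm (Fin n)) (u : Fin n) :
    doublePerm σ (Fin.castAdd n u) = Fin.castAdd n (σ u) := by
  rw [doublePerm, Equiv.permCongr_apply, finSumFinEquiv_symm_apply_castAdd, Equiv.sumCongr_apply, Sum.map_inl,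
    finSumFinEquiv_apply_left]

/-- On right halves. [folklore] -/
@[simp] theorem doublePerm_natAdd (σ : Equiv.Perm (Fin n)) (u : Fin n) :
    doublePerm σ (Fin.natAdd n u) = Fin.natAdd n (σ u) := by
  rw [doublePerm, Equiv.permCongr_apply, finSumFinEquiv_symm_apply_natAdd, Equiv.sumCongr_apply, Sum.map_inr,
    finSumFinEquiv_apply_right]

/-- Inverses. [folklore] -/
theorem doublePerm_symm (σ : Equiv.Perm (Fin n)) : (doublePerm σ).symm = doublePerm σ.symm := by
  refine Equiv.ext fun p => ?_
  refine Fin.addCases (fun u => ?_) (fun u => ?_) p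
  · rw [Equiv.symm_apply_eq, doublePerm_castAdd, doublePerm_castAdd, Equiv.apply_symm_apply]
  · rw [Equiv.symm_apply_eq, doublePerm_natAdd, doublePerm_natAdd, Equiv.apply_symm_apply]

/-- **The action on sequences**: `(σ · I)_p = I_{σ⁻¹ p}` with `σ` doubled. [folklore] -/
def actSeq (σ : Equiv.Perm (Fin n)) (I : Fin (n + n) → α) : Fin (n + n) → α := fun p => I ((doublePerm σ).symm p)

/-- The pair sequence of `σ · I` is `σ ·` (the pair sequence of `I`). [folklore] -/
theorem halfPairs_actSeq (σ : Equiv.Perm (Fin n)) (I : Fin (n + n) → α) :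
    halfPairs (actSeq σ I) = chunkPerm σ (halfPairs I) := by
  funext u
  simp only [halfPairs_apply, actSeq, chunkPerm_apply, doublePerm_symm, doublePerm_castAdd, doublePerm_natAdd]

/-- `σ⁻¹ · (σ · I) = I`. [folklore] -/
@[simp] theorem actSeq_symm_actSeq (σ : Equiv.Perm (Fin n)) (I : Fin (n + n) → α) : actSeq σ.symm (actSeq σ I) = I := by
  funext p
  simp only [actSeq, doublePerm_symm, Equiv.symm_symm]
  rw [← doublePerm_symm, Equiv.symm_apply_apply]

/-- `σ · (σ⁻¹ · I) = I`. [folklore] -/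
@[simp] theorem actSeq_actSeq_symm (σ : Equiv.Perm (Fin n)) (I : Fin (n + n) → α) : actSeq σ (actSeq σ.symm I) = I := by
  have := actSeq_symm_actSeq σ.symm I
  rwa [Equiv.symm_symm] at this

/-- Values of `σ · I`: `(σ · I)_{σ p} = I_p` on left halves. [folklore] -/
theorem actSeq_castAdd (σ : Equiv.Perm (Fin n)) (I : Fin (n + n) → α) (u : Fin n) :
    actSeq σ I (Fin.castAdd n u) = I (Fin.castAdd n (σ.symm u)) := by
  simp only [actSeq, doublePerm_symm, doublePerm_castAdd]

/-- Values of `σ · I` on right halves. [folklore] -/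
theorem actSeq_natAdd (σ : Equiv.Perm (Fin n)) (I : Fin (n + n) → α) (u : Fin n) :
    actSeq σ I (Fin.natAdd n u) = I (Fin.natAdd n (σ.symm u)) := by
  simp only [actSeq, doublePerm_symm, doublePerm_natAdd]

end HalfPairs

/-! ## Transitivity of the chunk symmetries on multi-class type classes -/

section Transitive

variable {n s : ℕ} (τ : Fin n → Fin s) {A : Type*} [Fintype A] [DecidableEq A]

/-- **The chunk symmetries act transitively on a multi-class type class of the term map**: two words
with the same letter counts on every term differ by a permutation of the chunks within the terms.
[cite: VassilevskaWilliamsXuXuZhou2024, §7 (proof of Cor. 4.2, "symmetry of the chunks within the same term") and Claim 5.6 (proof, "by symmetry")] -/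
theorem exists_chunkSymm_chunkPerm_eq {k : Fin s → A → ℕ} {w w' : Fin n → A}
    (hw : w ∈ multiTypeClass τ k) (hw' : w' ∈ multiTypeClass τ k) :
    ∃ σ ∈ chunkSymmetries τ, chunkPerm σ w = w' := by
  classical
  -- the words `u ↦ (τ u, w u)` and `u ↦ (τ u, w' u)` have the same type
  have htype : letterCount (fun u => (τ u, w u)) = letterCount (fun u => (τ u, w' u)) := by
    funext ta
    obtain ⟨t, a⟩ := ta
    have h1 := (mem_multiTypeClass.1 hw) t a
    have h2 := (mem_multiTypeClass.1 hw') t a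
    rw [countOn_apply, filter_filter] at h1 h2
    simp only [letterCount_apply, Prod.mk.injEq]
    rw [h1, h2]
  obtain ⟨σ, hσ⟩ := exists_perm_of_letterCount_eq htype
  refine ⟨σ, ?_, ?_⟩
  · rw [mem_chunkSymmetries]
    intro u
    exact congrArg Prod.fst (hσ u)
  · funext u
    have h := congrArg Prod.snd (hσ (σ.symm u))
    simpa using h.symm

/-- Multi-class type classes of the term map are stable under its chunk symmetries. [folklore] -/
theorem chunkPerm_mem_multiTypeClass {k : Fin s → A → ℕ} {σ : Equiv.Perm (Fin n)} (hσ : σ ∈ chunkSymmetries τ)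
    {w : Fin n → A} (hw : w ∈ multiTypeClass τ k) : chunkPerm σ w ∈ multiTypeClass τ k := by
  refine mem_multiTypeClass.2 fun t a => ?_
  rw [countOn_apply, card_filter_chunkPerm_eq σ (symm_mem_fibre_iff hσ t) w a, ← countOn_apply]
  exact (mem_multiTypeClass.1 hw) t a

end Transitive

/-! ## The remaining level-`(ℓ−1)` blocks: prescribed pair counts on every term -/

section PairTypeClass

variable {n s : ℕ} (τ : Fin n → Fin s) {α : Type*} [Fintype α] [DecidableEq α]

/-- **The sequences on half-chunk positions with prescribed pair counts on every term** — for block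
indices: the remaining level-`(ℓ−1)` `W`-blocks (`numxblock = |pairTypeClass τ k_X|`, the index
sequences whose pair sequence has the pair counts `k t = n_t · γ̃_{W,t}` on the chunks of every term `t`;
sequences inconsistent with `γ̃_{W,t}` on some term are zeroed out); for chunk shapes: the level-1
sequences with prescribed level-`ℓ` complete split distributions on every term.
[cite: VassilevskaWilliamsXuXuZhou2024, §6.2 (first paragraph, numxblock) and Def. 6.12 ("K̂ has level-ℓ complete split distributions {ξ_{Z,t}}")] -/
def pairTypeClass (k : Fin s → α × α → ℕ) : Finset (Fin (n + n) → α) :=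
  univ.filter fun I => halfPairs I ∈ multiTypeClass τ k

/-- Membership. [folklore] -/
theorem mem_pairTypeClass {k : Fin s → α × α → ℕ} {I : Fin (n + n) → α} :
    I ∈ pairTypeClass τ k ↔ halfPairs I ∈ multiTypeClass τ k := by
  simp [pairTypeClass]

/-- **Transitivity**: two sequences with the same pair counts on every term differ by a chunk symmetry
acting on both halves ("by symmetry between level-ℓ positions"). [cite: VassilevskaWilliamsXuXuZhou2024, Claim 5.6 (proof, "by symmetry, each X-block …") and Def. 6.12] -/
theorem exists_chunkSymm_of_mem_pairTypeClass {k : Fin s → α × α → ℕ}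
    {I I' : Fin (n + n) → α} (hI : I ∈ pairTypeClass τ k) (hI' : I' ∈ pairTypeClass τ k) :
    ∃ σ ∈ chunkSymmetries τ, actSeq σ I = I' := by
  obtain ⟨σ, hσ, he⟩ := exists_chunkSymm_chunkPerm_eq τ (mem_pairTypeClass τ|>.1 hI) (mem_pairTypeClass τ|>.1 hI')
  refine ⟨σ, hσ, halfPairs_injective ?_⟩
  rw [halfPairs_actSeq, he]

/-- These classes are stable under the chunk symmetries. [folklore] -/
theorem actSeq_mem_pairTypeClass {k : Fin s → α × α → ℕ} {σ : Equiv.Perm (Fin n)}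
    (hσ : σ ∈ chunkSymmetries τ) {I : Fin (n + n) → α} (hI : I ∈ pairTypeClass τ k) :
    actSeq σ I ∈ pairTypeClass τ k := by
  rw [mem_pairTypeClass, halfPairs_actSeq]
  exact chunkPerm_mem_multiTypeClass τ hσ (mem_pairTypeClass τ|>.1 hI)

/-- **The class of a sequence**: every sequence lies in the class of its own pair counts. [folklore] -/
theorem mem_pairTypeClass_self (I : Fin (n + n) → α) :
    I ∈ pairTypeClass τ (fun t a => countOn (classOf τ t) (halfPairs I) a) := by
  rw [mem_pairTypeClass, mem_multiTypeClass]
  intro t a; rfl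

/-- **Remaining blocks lie inside the level-`ℓ` blocks** when the pair counts of every term are
supported on pairs summing to the level-`ℓ` index of that term (as `n_t γ̃_{X,t}` is, `γ̃_{X,t}` being
the one-level split of a distribution on shapes of level `i_t`). [cite: VassilevskaWilliamsXuXuZhou2024, §6 (preamble: "each level-ℓ index i_t splits into two level-(ℓ−1) indices (l_X, i_t − l_X)")] -/
theorem insideX_of_mem_pairTypeClass {c : ℕ} (L : Fin s → InterfaceTerm (c + c)) {k : Fin s → Fin (2 * c + 1) × Fin (2 * c + 1) → ℕ}
    (hk : ∀ t lr, k t lr ≠ 0 → (lr.1 : ℕ) + lr.2 = (L t).i) {I : Fin (n + n) → Fin (2 * c + 1)}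
    (hI : I ∈ pairTypeClass τ k) : InsideX τ L I := by
  intro u
  have hw := (mem_multiTypeClass.1 (mem_pairTypeClass τ|>.1 hI)) (τ u) (halfPairs I u)
  have hpos : 0 < countOn (classOf τ (τ u)) (halfPairs I) (halfPairs I u) := by
    rw [countOn_apply]; exact card_pos.2 ⟨u, by simp⟩
  rw [hw] at hpos
  exact hk (τ u) (halfPairs I u) hpos.ne'

/-- The same for `Y`. [cite: VassilevskaWilliamsXuXuZhou2024, §6 (preamble)] -/
theorem insideY_of_mem_pairTypeClass {c : ℕ} (L : Fin s → InterfaceTerm (c + c)) {k : Fin s → Fin (2 * c + 1) × Fin (2 * c + 1) → ℕ}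
    (hk : ∀ t lr, k t lr ≠ 0 → (lr.1 : ℕ) + lr.2 = (L t).j) {J : Fin (n + n) → Fin (2 * c + 1)}
    (hJ : J ∈ pairTypeClass τ k) : InsideY τ L J := by
  intro u
  have hw := (mem_multiTypeClass.1 (mem_pairTypeClass τ|>.1 hJ)) (τ u) (halfPairs J u)
  have hpos : 0 < countOn (classOf τ (τ u)) (halfPairs J) (halfPairs J u) := by
    rw [countOn_apply]; exact card_pos.2 ⟨u, by simp⟩
  rw [hw] at hpos
  exact hk (τ u) (halfPairs J u) hpos.ne'

/-- The same for `Z`. [cite: VassilevskaWilliamsXuXuZhou2024, §6 (preamble)] -/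
theorem insideZ_of_mem_pairTypeClass {c : ℕ} (L : Fin s → InterfaceTerm (c + c)) {k : Fin s → Fin (2 * c + 1) × Fin (2 * c + 1) → ℕ}
    (hk : ∀ t lr, k t lr ≠ 0 → (lr.1 : ℕ) + lr.2 = (L t).k) {K : Fin (n + n) → Fin (2 * c + 1)}
    (hK : K ∈ pairTypeClass τ k) : InsideZ τ L K := by
  intro u
  have hw := (mem_multiTypeClass.1 (mem_pairTypeClass τ|>.1 hK)) (τ u) (halfPairs K u)
  have hpos : 0 < countOn (classOf τ (τ u)) (halfPairs K) (halfPairs K u) := by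
    rw [countOn_apply]; exact card_pos.2 ⟨u, by simp⟩
  rw [hw] at hpos
  exact hk (τ u) (halfPairs K u) hpos.ne'

end PairTypeClass

/-! ## The universe of level-`(ℓ−1)` block triples and the symmetry of its degrees -/

section Universe

variable {n s P : ℕ} (τ : Fin n → Fin s) (kX kY kZ : Fin s → Fin (P + 1) × Fin (P + 1) → ℕ)

/-- **The remaining level-`(ℓ−1)` block triples `𝒯`** (`numtriple = |𝒯|`): triples of remaining blocks
with `I_p + J_p + K_p = P` at every half-chunk position. [cite: VassilevskaWilliamsXuXuZhou2024, §6.2 ("let numtriple be the number of remaining level-(ℓ−1) block triples X_I Y_J Z_K")] -/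
def tripleUniverse : Finset ((Fin (n + n) → Fin (P + 1)) × (Fin (n + n) → Fin (P + 1)) × (Fin (n + n) → Fin (P + 1))) :=
  (pairTypeClass τ kX ×ˢ pairTypeClass τ kY ×ˢ pairTypeClass τ kZ).filter fun T =>
    ∀ p, (T.1 p : ℕ) + T.2.1 p + T.2.2 p = P

variable {τ kX kY kZ}

/-- Membership. [folklore] -/
theorem mem_tripleUniverse {T : (Fin (n + n) → Fin (P + 1)) × (Fin (n + n) → Fin (P + 1)) × (Fin (n + n) → Fin (P + 1))} :
    T ∈ tripleUniverse τ kX kY kZ ↔ (T.1 ∈ pairTypeClass τ kX ∧ T.2.1 ∈ pairTypeClass τ kY ∧ T.2.2 ∈ pairTypeClass τ kZ) ∧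
      ∀ p, (T.1 p : ℕ) + T.2.1 p + T.2.2 p = P := by
  rw [tripleUniverse, mem_filter, mem_product, mem_product]

/-- **The universe is a family of level triples.** [cite: VassilevskaWilliamsXuXuZhou2024, §6.2] -/
theorem levelSum_of_mem_tripleUniverse {T : (Fin (n + n) → Fin (P + 1)) × (Fin (n + n) → Fin (P + 1)) × (Fin (n + n) → Fin (P + 1))}
    (hT : T ∈ tripleUniverse τ kX kY kZ) (p : Fin (n + n)) : seqVal T.1 p + seqVal T.2.1 p + seqVal T.2.2 p = P :=
  (mem_tripleUniverse.1 hT).2 p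

/-- The action of a chunk permutation on a triple. [folklore] -/
def permTriple (σ : Equiv.Perm (Fin n)) (T : (Fin (n + n) → Fin (P + 1)) × (Fin (n + n) → Fin (P + 1)) × (Fin (n + n) → Fin (P + 1))) :
    (Fin (n + n) → Fin (P + 1)) × (Fin (n + n) → Fin (P + 1)) × (Fin (n + n) → Fin (P + 1)) :=
  (actSeq σ T.1, actSeq σ T.2.1, actSeq σ T.2.2)

/-- `σ⁻¹ · (σ · T) = T`. [folklore] -/
@[simp] theorem permTriple_symm_permTriple (σ : Equiv.Perm (Fin n))
    (T : (Fin (n + n) → Fin (P + 1)) × (Fin (n + n) → Fin (P + 1)) × (Fin (n + n) → Fin (P + 1))) :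
    permTriple σ.symm (permTriple σ T) = T := by
  simp [permTriple]

/-- `σ · (σ⁻¹ · T) = T`. [folklore] -/
@[simp] theorem permTriple_permTriple_symm (σ : Equiv.Perm (Fin n))
    (T : (Fin (n + n) → Fin (P + 1)) × (Fin (n + n) → Fin (P + 1)) × (Fin (n + n) → Fin (P + 1))) :
    permTriple σ (permTriple σ.symm T) = T := by
  simp [permTriple]

/-- **The universe is stable under the chunk symmetries.** [cite: VassilevskaWilliamsXuXuZhou2024, Claim 5.6 (proof, "by symmetry")] -/
theorem permTriple_mem_tripleUniverse {σ : Equiv.Perm (Fin n)} (hσ : σ ∈ chunkSymmetries τ)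
    {T : (Fin (n + n) → Fin (P + 1)) × (Fin (n + n) → Fin (P + 1)) × (Fin (n + n) → Fin (P + 1))}
    (hT : T ∈ tripleUniverse τ kX kY kZ) : permTriple σ T ∈ tripleUniverse τ kX kY kZ := by
  rw [mem_tripleUniverse] at hT ⊢
  obtain ⟨⟨hX, hY, hZ⟩, hlev⟩ := hT
  refine ⟨⟨actSeq_mem_pairTypeClass τ hσ hX, actSeq_mem_pairTypeClass τ hσ hY, actSeq_mem_pairTypeClass τ hσ hZ⟩, fun p => ?_⟩
  exact hlev _

/-- **"By symmetry, each `X`-block is in the same number of block triples"**: the `X`-degree in `𝒯`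
is the same for all remaining `X`-blocks. [cite: VassilevskaWilliamsXuXuZhou2024, Claim 5.6 (proof), used for Claim 6.7] -/
theorem card_filter_fst_eq_eq {I I' : Fin (n + n) → Fin (P + 1)} (hI : I ∈ pairTypeClass τ kX) (hI' : I' ∈ pairTypeClass τ kX) :
    ((tripleUniverse τ kX kY kZ).filter fun T => T.1 = I).card = ((tripleUniverse τ kX kY kZ).filter fun T => T.1 = I').card := by
  obtain ⟨σ, hσ, he⟩ := exists_chunkSymm_of_mem_pairTypeClass τ hI hI'
  have hσ' : σ.symm ∈ chunkSymmetries τ := (chunkSymmetries τ).inv_mem hσ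
  have he' : actSeq σ.symm I' = I := by rw [← he, actSeq_symm_actSeq]
  refine card_nbij' (permTriple σ) (permTriple σ.symm) (fun T hT => ?_) (fun T hT => ?_)
    (fun T _ => permTriple_symm_permTriple σ T) (fun T _ => permTriple_permTriple_symm σ T)
  · have hT' := mem_filter.1 (mem_coe.1 hT)
    refine mem_coe.2 (mem_filter.2 ⟨permTriple_mem_tripleUniverse hσ hT'.1, ?_⟩)
    show actSeq σ T.1 = I'
    rw [hT'.2, he]
  · have hT' := mem_filter.1 (mem_coe.1 hT)
    refine mem_coe.2 (mem_filter.2 ⟨permTriple_mem_tripleUniverse hσ' hT'.1, ?_⟩)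
    show actSeq σ.symm T.1 = I
    rw [hT'.2, he']

/-- The same for the `Y`-degree. [cite: VassilevskaWilliamsXuXuZhou2024, Claim 5.6 (proof)] -/
theorem card_filter_snd_eq_eq {J J' : Fin (n + n) → Fin (P + 1)} (hJ : J ∈ pairTypeClass τ kY) (hJ' : J' ∈ pairTypeClass τ kY) :
    ((tripleUniverse τ kX kY kZ).filter fun T => T.2.1 = J).card = ((tripleUniverse τ kX kY kZ).filter fun T => T.2.1 = J').card := by
  obtain ⟨σ, hσ, he⟩ := exists_chunkSymm_of_mem_pairTypeClass τ hJ hJ'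
  have hσ' : σ.symm ∈ chunkSymmetries τ := (chunkSymmetries τ).inv_mem hσ
  have he' : actSeq σ.symm J' = J := by rw [← he, actSeq_symm_actSeq]
  refine card_nbij' (permTriple σ) (permTriple σ.symm) (fun T hT => ?_) (fun T hT => ?_)
    (fun T _ => permTriple_symm_permTriple σ T) (fun T _ => permTriple_permTriple_symm σ T)
  · have hT' := mem_filter.1 (mem_coe.1 hT)
    refine mem_coe.2 (mem_filter.2 ⟨permTriple_mem_tripleUniverse hσ hT'.1, ?_⟩)
    show actSeq σ T.2.1 = J'
    rw [hT'.2, he]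
  · have hT' := mem_filter.1 (mem_coe.1 hT)
    refine mem_coe.2 (mem_filter.2 ⟨permTriple_mem_tripleUniverse hσ' hT'.1, ?_⟩)
    show actSeq σ.symm T.2.1 = J
    rw [hT'.2, he']

/-- **`deg_X · numxblock = numtriple`**: `#{T ∈ 𝒯 | T.1 = I} · |pairTypeClass τ kX| = |𝒯|` for every
remaining `I` ("which is `numtriple/numxblock`"). [cite: VassilevskaWilliamsXuXuZhou2024, Claim 5.6 (proof) and §6.2 (the requirement M₀ ≥ 8 · numtriple/numxblock)] -/
theorem degX_mul_card_pairTypeClass {I : Fin (n + n) → Fin (P + 1)} (hI : I ∈ pairTypeClass τ kX) :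
    ((tripleUniverse τ kX kY kZ).filter fun T => T.1 = I).card * (pairTypeClass τ kX).card = (tripleUniverse τ kX kY kZ).card := by
  rw [card_eq_sum_card_fiberwise (f := fun T => T.1) (s := tripleUniverse τ kX kY kZ) (t := pairTypeClass τ kX)
    (fun T hT => (mem_tripleUniverse.1 hT).1.1), mul_comm]
  symm
  exact Finset.sum_const_nat fun I' hI' => card_filter_fst_eq_eq hI' hI

/-- **`deg_Y · numyblock = numtriple`.** [cite: VassilevskaWilliamsXuXuZhou2024, Claim 5.6 (proof) and §6.2] -/
theorem degY_mul_card_pairTypeClass {J : Fin (n + n) → Fin (P + 1)} (hJ : J ∈ pairTypeClass τ kY) :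
    ((tripleUniverse τ kX kY kZ).filter fun T => T.2.1 = J).card * (pairTypeClass τ kY).card = (tripleUniverse τ kX kY kZ).card := by
  rw [card_eq_sum_card_fiberwise (f := fun T => T.2.1) (s := tripleUniverse τ kX kY kZ) (t := pairTypeClass τ kY)
    (fun T hT => (mem_tripleUniverse.1 hT).1.2.1), mul_comm]
  symm
  exact Finset.sum_const_nat fun J' hJ' => card_filter_snd_eq_eq hJ' hJ

/-- **The requirement `M ≥ 8 · numtriple/numxblock` bounds the `X`-degrees**: `8 |𝒯| ≤ M · numxblock`
gives `8 · deg_X(T) ≤ M` for every `T ∈ 𝒯`. [cite: VassilevskaWilliamsXuXuZhou2024, §6.2 (the requirement on M₀)] -/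
theorem eight_mul_degX_le {M : ℕ} (h8 : 8 * (tripleUniverse τ kX kY kZ).card ≤ M * (pairTypeClass τ kX).card)
    {T : (Fin (n + n) → Fin (P + 1)) × (Fin (n + n) → Fin (P + 1)) × (Fin (n + n) → Fin (P + 1))}
    (hT : T ∈ tripleUniverse τ kX kY kZ) :
    8 * ((tripleUniverse τ kX kY kZ).filter fun T' => T'.1 = T.1).card ≤ M := by
  have hI : T.1 ∈ pairTypeClass τ kX := (mem_tripleUniverse.1 hT).1.1
  have hpos : 0 < (pairTypeClass τ kX).card := card_pos.2 ⟨T.1, hI⟩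
  refine Nat.le_of_mul_le_mul_right ?_ hpos
  calc 8 * ((tripleUniverse τ kX kY kZ).filter fun T' => T'.1 = T.1).card * (pairTypeClass τ kX).card
      = 8 * (tripleUniverse τ kX kY kZ).card := by rw [mul_assoc, degX_mul_card_pairTypeClass hI]
    _ ≤ M * (pairTypeClass τ kX).card := h8

/-- **The requirement `M ≥ 8 · numtriple/numyblock` bounds the `Y`-degrees.** [cite: VassilevskaWilliamsXuXuZhou2024, §6.2] -/
theorem eight_mul_degY_le {M : ℕ} (h8 : 8 * (tripleUniverse τ kX kY kZ).card ≤ M * (pairTypeClass τ kY).card)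
    {T : (Fin (n + n) → Fin (P + 1)) × (Fin (n + n) → Fin (P + 1)) × (Fin (n + n) → Fin (P + 1))}
    (hT : T ∈ tripleUniverse τ kX kY kZ) :
    8 * ((tripleUniverse τ kX kY kZ).filter fun T' => T'.2.1 = T.2.1).card ≤ M := by
  have hJ : T.2.1 ∈ pairTypeClass τ kY := (mem_tripleUniverse.1 hT).1.2.1
  have hpos : 0 < (pairTypeClass τ kY).card := card_pos.2 ⟨T.2.1, hJ⟩
  refine Nat.le_of_mul_le_mul_right ?_ hpos
  calc 8 * ((tripleUniverse τ kX kY kZ).filter fun T' => T'.2.1 = T.2.1).card * (pairTypeClass τ kY).card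
      = 8 * (tripleUniverse τ kX kY kZ).card := by rw [mul_assoc, degY_mul_card_pairTypeClass hJ]
    _ ≤ M * (pairTypeClass τ kY).card := h8

end Universe

end Literature.Computability.AlgebraicComplexity
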